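/- Copyright: the b2b-balaban cell (near-miss cell 7), T⁴-continuum fan-out; row NE7b ROUND-2 swarm, seat
t4-ne7b-formalise-leaf-09 (gen 5) (sub-row S12i-opt «NON-VACUITY TOY of `CountRoadWitnessT3b`» of
`t4/b2b-balaban-t4-ne7b-p1/LEAVES-NE7b.md`, owner booking v3.43 journal l.15717; the S12h pattern of this lineage's
`HistoryRealiseCellsRunApexWitness{,Data}` carried over to the END OF RECORD v3′ apex).  Released under the licence of the
surrounding project. -/
import Summits.QuantumFields.BalabanUV.T4Continuum.Support.HistoryRealiseCellsRunApexT3b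
import Summits.QuantumFields.BalabanUV.T4Continuum.Support.HistoryRealiseCellsRunApexWitnessData

/-!
# Realised histories at the apex over END v3′: the `CountRoadWitnessT3b` shape is NON-VACUOUS (row S12i-opt)

Summits-side support leaf of the T⁴-continuum cell (rung (B)+1 on a FINITE torus only; NOT infinite volume, NOT the
mass gap, NOT the Clay statement; NOT a proof of the spine estimate NE7b).  Row NE7b, route «COUNT», sub-row S12i-opt
(owner ruling R-OWNER-23-9 (C) «non-vacuity toy optional (S12h pattern)», booked v3.43 to this lineage; typer ACCEPT §X
test X6): the decided toy of row S12h (`HistoryRealiseCellsRunApexWitness`: `toyData` = the tree's placeholder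
inhabitant with `χ := 1`; `HistoryRealiseCellsRunApexWitnessData`: general constant run, any loop string with trivial
product observable) inhabits leaf-02 gen 9's apex structure `CountRoadWitnessT3b` over the END OF RECORD v3′
(`HistoryRealiseCellsRunMultEndD.hybridNE7_of_realisedDomainsRun_printedT3bD`: multiplicity PROVED, `hdis` read from
`DisjointJoins`∕`BoxedBirths`).  [decided toy] on OUR carriers; no `[cite:]` tag; no `def … : Prop`; nothing printed
is asserted.

WHAT.
* §1 `not_mem_badGMems_toy`: with NO live component there is no bad term (S12h), hence no fine (key) class of the
  multiplicity road (`HistoryAssemblyMult.badGMems`) — every key-family numerator field of END v3′ is vacuous on the toy.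
* §2 **`toyWitnessT3bOf`**: every field of `CountRoadWitnessT3b (toyData F G) C O rr d n hn g₀ os Unit Empty Unit` for a
  CONSTANT run `g₀ ≡ g` and a string `os` whose product observable is `≡ 1`, for EVERY `C O rr d n`: the S12h∕S12h-Data
  witnesses field for field (E1∕E2 by `ZtoyOf`, the NE7 core budget met EXACTLY with `ν := nuToyOf`, the (γ) floor with
  `c₀ := 1` by `smallFieldMass_toy`, sites with `n₁ := 0`, (2.5) by `Rsz`, `liveC := ∅`); the NEW END-v3′ fields —
  live components dated ≤ cutoff, `DisjointJoins`, `BoxedBirths`, the key-family price∕numerator readings — are VACUOUS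
  (no live component: `Empty.elim`; no bad term: `not_mem_badTerms_toy`; no fine class: §1).
* §3 The corollaries in the apex's letters: `toyWitnessT3b` (empty string, `g₀ ≡ 1`), `nonempty_countRoadWitnessT3b_toy`,
  `exists_tuned_countRoadWitnessT3b_toy` (the apex quantifier pattern), and THE APEX'S OWN ANTECEDENT SHAPE
  `ForSmallCouplings (toyData F G) (fun g₀ => ∀ os, ∃ ι α π …, Nonempty (CountRoadWitnessT3b …))` on a subsingleton
  gauge group ∕ at `SU(1)` (`forSmallCouplings_countRoadWitnessT3b_toy{,SU1}`) — `hData` of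
  `hybridNE7Under_of_countRoadT3b_fsc` VERBATIM on one datum.
* §4 The located obstruction on the tree's own placeholder `stubData` (χ := 0): the shape is EMPTY there, by the (γ)
  floor field alone (`isEmpty_countRoadWitnessT3b_stubData`) — «satisfiable» on the χ := 1 twin, «satisfiable modulo
  ⟨floor⟩ only» on the placeholder, exactly as for S12h.

HONEST (typer DV-13 wording).  A node test of a hypothesis SHAPE on a decided toy where (B) FAILS
(`not_endStatementBPrinted_toy`): NO instance of `HybridNE7Under` ∕ `ContinuumYM4Torus` is or could be derived from it
through the apex∕headline theorems (their binder `hB`).  The empty live-component sets make every H3-side field —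
old and new — vacuous BY DESIGN; for a non-empty string on a non-trivial group the source-uniformity of
`ReindexedBudget` with summable rates is NE7's two-run comparison itself, available on no toy.  The constants-side
binders of the apex theorem (`θ hθ hslack hθJ`, signs, stride∕decay arithmetic) are NOT fields of the structure and
are not touched here (their satisfiability is the constants-side census, another seat's row).  Discharges NOTHING of
the nine spine estimates; NE7b NOT proved; spine 0∕9.  HONEST DEPENDENCY (cell): continuum YM on T⁴ ⇐ BetaPertH ∧ nine
spine estimates (0/9 proved); BetaPertH ⇐ (D1) ∧ (D4) ∧ CAP+tail; G-an2-4 gates asym, D1 and NE2/3/4. -/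

open Finset MeasureTheory
open Literature.MathematicalPhysics.QuantumFieldTheory.Balaban1983to89
open Literature.MathematicalPhysics.QuantumFieldTheory.Balaban1983to89.B13ScaleTransfer
open Literature.MathematicalPhysics.QuantumFieldTheory.Balaban1983to89.T4FiniteEpsInhabited
open Missing AveragingRT T4Continuum T4StabilitySocket T4MatchingClosure T4IndicatorShell T4LiveClassFibration
open T4RenewalChains T4PersistenceDictionary T4BranchingRecordsGas T4ContinuumYM4Torus
open Summit.QuantumFields.BalabanUV.T4Continuum.HistoryConstants
open Summit.QuantumFields.BalabanUV.T4Continuum.HistoryGen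
open Summit.QuantumFields.BalabanUV.T4Continuum.HistoryAssemblyTerms
open Summit.QuantumFields.BalabanUV.T4Continuum.HistoryAssemblyPedigree
open Summit.QuantumFields.BalabanUV.T4Continuum.HistoryAssemblyMult
open Summit.QuantumFields.BalabanUV.T4Continuum.HistorySocketTH
open Summit.QuantumFields.BalabanUV.T4Continuum.HistoryAssemblyRealiseRun
open Summit.QuantumFields.BalabanUV.T4Continuum.HistoryRealiseCellsRun
open Summit.QuantumFields.BalabanUV.T4Continuum.HistoryRealiseCellsRunApexT3b
open Summit.QuantumFields.BalabanUV.T4Continuum.HistoryRealiseCellsRunApexWitness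
open Summit.QuantumFields.BalabanUV.T4Continuum.HistoryRealiseCellsRunApexWitnessData

namespace Summit.QuantumFields.BalabanUV.T4Continuum.HistoryRealiseCellsRunApexWitnessT3b

noncomputable section

/-! ## §1 No live component ⇒ no fine class -/

section Vacuous

/-- with NO live component there is no bad term (`not_mem_badTerms_toy`), hence NO fine (key) class of the
multiplicity road: `badGMems (memOf toyPedR toyLive cellOf) jstar T gmem K` is empty, whatever the key map `gmem`.
[decided toy] -/
theorem not_mem_badGMems_toy {γ ω : Type*} [DecidableEq γ] [DecidableEq ω] (cellOf : ℕ → Unit → Empty → γ)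
    (jstar : ℕ → ℕ) (T : ℕ → Finset Unit) (gmem : ℕ → Unit → Finset ω) {K : ℕ} {k : Finset ω}
    (h : k ∈ badGMems (memOf toyPedR toyLive cellOf) jstar T gmem K) : False := by
  obtain ⟨τ, hτ, -⟩ := mem_badGMems.1 h
  exact not_mem_badTerms_toy cellOf jstar T hτ

end Vacuous

/-! ## §2 The witness term over END v3′ -/

section Witness

variable (F : T4Family) (G : Type) [GaugeGroup G] [MeasurableSpace G] [HaarData G] [RegularGaugeGroup G]

/-- **THE WITNESS TERM OVER END v3′** for a CONSTANT run `g₀ ≡ g` and a string `os` with trivial product observable,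
for EVERY `C O rr d` and every torus side count `n > 0` (the structure's parameter `hn`; module docstring §2). [decided toy] -/
def toyWitnessT3bOf (C : T4PrintedShapeBanking.Consts) (O : PrintedO1s) (rr d n : ℕ) (hn : 0 < n) {g : ℝ} {g₀ : ℕ → ℝ}
    (hg₀ : ∀ K, g₀ K = g) {os : List (ULoop F)}
    (hobs : ∀ (K : ℕ) (U : GaugeField (F.P K) 0 G), T4GenFunBounds.prodObs ((toyData F G).scheme g₀) K os U = 1) :
    CountRoadWitnessT3b (toyData F G) C O rr d n hn g₀ os Unit Empty Unit where
  l₀ := 1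
  vol := 1
  l₀_pos := one_pos
  vol_pos := one_pos
  K₀ := 0
  T := toyT
  A := fun K t _ => ZtoyOf F G g₀ os K t
  A' := fun K t _ => ZtoyOf F G g₀ os (K + 1) t
  shA := fun _ _ _ => 0
  shB := fun _ _ _ => 0
  dead := fun _ _ _ => 0
  dead' := fun _ _ _ => 0
  nup := fun _ _ => 0
  mup := fun _ _ => 0
  Nup := 0
  Cc := fun K _ _ => nuToyOf F G g₀ os K
  Rr := fun _ _ _ => 0
  CcRec := fun _ _ _ => 0
  RrRec := fun _ _ _ => 0
  ν := nuToyOf F G g₀ os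
  u := fun _ => 0
  s₂ := fun _ => 0
  q₀ := fun _ => 0
  r := fun _ => 0
  s := fun _ => 0
  Wsh := fun _ => 0
  reprA := fun K t _ _ => by rw [toyT, sum_singleton]; rfl
  reprB := fun K t _ _ => by rw [toyT, sum_singleton]; rfl
  c₀ := 1
  n₁ := 0
  c₀_pos := one_pos
  floor := fun K _ => (smallFieldMass_toy F G K (g₀ K)).ge
  floor' := fun K _ => (smallFieldMass_toy F G (K + 1) (g₀ (K + 1))).ge
  sites := fun K _ => by rw [toy_numSites, Nat.cast_zero]
  sites' := fun K _ => by rw [toy_numSites, Nat.cast_zero]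
  Nup_nonneg := le_rfl
  nup_bd := fun _ _ _ _ => ⟨le_rfl, le_rfl⟩
  mup_bd := fun _ _ _ _ => ⟨le_rfl, le_rfl⟩
  R := fun _ _ => Rsz F rr g
  isRj := fun K s _ => by rw [toy_flow_g]; exact (hg₀ K).symm ▸ isRj_Rsz F rr g
  one_le_R := fun _ _ _ => one_le_Rsz F rr g
  ped := toyPedR
  cellP := fun _ _ _ => (fun _ => 0, ∅)
  liveC := toyLive
  Zd := fun _ _ c => c.elim
  realised :=
    ⟨fun _ _ _ _ c => c.elim, fun _ _ _ _ c => c.elim, fun _ _ _ _ c => c.elim, fun _ _ _ _ c => c.elim,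
      fun _ _ _ _ c => c.elim, fun _ _ _ _ c => c.elim, fun _ _ _ _ c => c.elim⟩
  -- NEW (END v3′): live components dated ≤ cutoff; disjoint constituents; boxed births — no live component
  step_le := fun _ _ _ _ c _ => c.elim
  disjointJoins := fun _ _ _ _ c _ => c.elim
  boxedBirths := fun _ _ _ _ c _ => c.elim
  κ := fun _ _ _ _ => 0
  κ' := fun _ _ _ _ => 0
  cost_le := fun _ _ τ hτ => (not_mem_badTerms_toy _ _ _ hτ).elim
  cost_le' := fun _ _ τ hτ => (not_mem_badTerms_toy _ _ _ hτ).elim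
  -- NEW (END v3′): the key-family price ∕ numerator readings — no bad term, no fine class
  FcM := fun _ _ => 0
  RfM := fun _ _ => 0
  FcM' := fun _ _ => 0
  RfM' := fun _ _ => 0
  priceM := fun _ _ _ _ τ hτ => (not_mem_badTerms_toy _ _ _ hτ).elim
  priceM' := fun _ _ _ _ τ hτ => (not_mem_badTerms_toy _ _ _ hτ).elim
  upM := fun _ _ _ _ k hk => (not_mem_badGMems_toy _ _ _ _ hk).elim
  deadM_nonneg := fun _ _ _ _ k hk => (not_mem_badGMems_toy _ _ _ _ hk).elim
  resumM := fun _ _ _ _ k hk => (not_mem_badGMems_toy _ _ _ _ hk).elim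
  FM_nonneg := fun _ _ _ _ k hk => (not_mem_badGMems_toy _ _ _ _ hk).elim
  upM' := fun _ _ _ _ k hk => (not_mem_badGMems_toy _ _ _ _ hk).elim
  deadM'_nonneg := fun _ _ _ _ k hk => (not_mem_badGMems_toy _ _ _ _ hk).elim
  resumM' := fun _ _ _ _ k hk => (not_mem_badGMems_toy _ _ _ _ hk).elim
  FM'_nonneg := fun _ _ _ _ k hk => (not_mem_badGMems_toy _ _ _ _ hk).elim
  shell :=
    { nonneg := fun _ => le_rfl
      summable := summable_zero
      sh_nonneg_left := fun _ _ _ _ _ => le_rfl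
      sh_le_left := fun K t _ _ _ => (ZtoyOf_pos F G g₀ os K t).le
      sh_nonneg_right := fun _ _ _ _ _ => le_rfl
      sh_le_right := fun K t _ _ _ => (ZtoyOf_pos F G g₀ os (K + 1) t).le
      left := fun _ _ _ => by simp
      right := fun _ _ _ => by simp }
  budget :=
    { nonneg := fun K t _ _ _ => by simpa only [sub_zero] using (ZtoyOf_pos F G g₀ os K t).le
      lower := fun K t _ _ _ => by simpa only [sub_zero] using (exp_nuToyOf_mul F G hobs K t).le
      upper := fun K t _ _ _ => by simpa only [sub_zero, add_zero] using (exp_nuToyOf_mul F G hobs K t).ge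
      uv_const := fun _ _ _ _ _ => by simp
      uv_radius := fun _ _ _ _ _ => by simp
      recent_remainder := fun _ _ _ _ _ => by simp
      recent_deviation := fun _ _ _ _ _ => by simp }
  sum_r := summable_zero
  sum_u := summable_zero
  sum_s := summable_zero
  sum_s₂ := summable_zero

end Witness

/-! ## §3 The corollaries in the apex's letters -/

section Apex

variable (F : T4Family) (G : Type) [GaugeGroup G] [MeasurableSpace G] [HaarData G] [RegularGaugeGroup G]

/-- **THE WITNESS FOR THE EMPTY STRING AT THE TUNED CONSTANT RUN `g₀ ≡ 1`**, for every `C O rr d n` (the S12h case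
over END v3′). [decided toy] -/
def toyWitnessT3b (C : T4PrintedShapeBanking.Consts) (O : PrintedO1s) (rr d n : ℕ) (hn : 0 < n) :
    CountRoadWitnessT3b (toyData F G) C O rr d n hn gOne ([] : List (ULoop F)) Unit Empty Unit :=
  toyWitnessT3bOf F G C O rr d n hn (g := 1) (fun _ => rfl) fun K U => prodObs_nil G ((toyData F G).scheme gOne) K U

/-- **ROW S12i-opt — THE END-v3′ WITNESS SHAPE IS JOINTLY SATISFIABLE** (for every `C O rr d n`, on the toy datum, for
the empty string at `g₀ ≡ 1`).  A node test of a hypothesis SHAPE; (B) fails at this datum; discharges nothing of the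
nine spine estimates; NE7b NOT proved. [decided toy] -/
theorem nonempty_countRoadWitnessT3b_toy (C : T4PrintedShapeBanking.Consts) (O : PrintedO1s) (rr d n : ℕ) (hn : 0 < n) :
    Nonempty (CountRoadWitnessT3b (toyData F G) C O rr d n hn gOne ([] : List (ULoop F)) Unit Empty Unit) :=
  ⟨toyWitnessT3b F G C O rr d n hn⟩

/-- … in the apex's quantifier pattern: a positive `γ`, a positive `g`, a run tuned to them, and for the (empty)
string the index and payload types with their decidable equalities and an inhabited witness. [decided toy] -/
theorem exists_tuned_countRoadWitnessT3b_toy (C : T4PrintedShapeBanking.Consts) (O : PrintedO1s) (rr d n : ℕ) (hn : 0 < n) :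
    ∃ (γ g : ℝ) (g₀ : ℕ → ℝ), 0 < γ ∧ 0 < g ∧ (toyData F G).Tuned γ g g₀ ∧
      ∃ (ι α π : Type) (_ : DecidableEq ι) (_ : DecidableEq α) (_ : DecidableEq π),
        Nonempty (CountRoadWitnessT3b (toyData F G) C O rr d n hn g₀ ([] : List (ULoop F)) ι α π) :=
  ⟨1, 1, gOne, one_pos, one_pos, tuned_toy F G, Unit, Empty, Unit, inferInstance, inferInstance, inferInstance,
    nonempty_countRoadWitnessT3b_toy F G C O rr d n hn⟩

/-- For the record, on ANY regular gauge group the EMPTY string is covered at every tuned run. [decided toy] -/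
theorem nonempty_countRoadWitnessT3b_toy_nil (C : T4PrintedShapeBanking.Consts) (O : PrintedO1s) (rr d n : ℕ)
    (hn : 0 < n) {γ g : ℝ} {g₀ : ℕ → ℝ} (ht : (toyData F G).Tuned γ g g₀) :
    Nonempty (CountRoadWitnessT3b (toyData F G) C O rr d n hn g₀ ([] : List (ULoop F)) Unit Empty Unit) :=
  ⟨toyWitnessT3bOf F G C O rr d n hn ((tuned_const_iff F G γ g g₀).1 ht).1 fun K U =>
    prodObs_nil G ((toyData F G).scheme g₀) K U⟩

/-- **THE APEX'S DISPLAYED ANTECEDENT `hData` OF `hybridNE7Under_of_countRoadT3b_fsc` HOLDS ON THE TOY DATUM over a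
subsingleton regular gauge group** (every loop variable is `1`): `ForSmallCouplings (toyData F G) (fun g₀ => ∀ os,
∃ ι α π …, Nonempty (CountRoadWitnessT3b …))`, thresholds `γ₀ = g₁ = 1`.  A node test of the SHAPE ((B) fails at this
datum); discharges nothing of the nine; NE7b NOT proved. [decided toy] -/
theorem forSmallCouplings_countRoadWitnessT3b_toy [Subsingleton G] (C : T4PrintedShapeBanking.Consts)
    (O : PrintedO1s) (rr d n : ℕ) (hn : 0 < n) :
    ForSmallCouplings (toyData F G) fun g₀ => ∀ os : List (ULoop F),
      ∃ (ι α π : Type) (_ : DecidableEq ι) (_ : DecidableEq α) (_ : DecidableEq π),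
        Nonempty (CountRoadWitnessT3b (toyData F G) C O rr d n hn g₀ os ι α π) := by
  refine ⟨1, one_pos, fun γ _ _ => ⟨1, one_pos, fun g _ _ g₀ ht os => ?_⟩⟩
  have hg₀ : ∀ K, g₀ K = g := ((tuned_const_iff F G γ g g₀).1 ht).1
  exact ⟨Unit, Empty, Unit, inferInstance, inferInstance, inferInstance,
    ⟨toyWitnessT3bOf F G C O rr d n hn hg₀ (fun K U => prodObs_eq_one (toyData F G) g₀ K os U)⟩⟩

/-- **… IN PARTICULAR AT `SU(1)`**, on every family `F`, for every `C O rr d n`. [decided toy] -/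
theorem forSmallCouplings_countRoadWitnessT3b_toySU1 (C : T4PrintedShapeBanking.Consts) (O : PrintedO1s)
    (rr d n : ℕ) (hn : 0 < n) :
    ForSmallCouplings (toyData F (Matrix.specialUnitaryGroup (Fin 1) ℂ)) fun g₀ => ∀ os : List (ULoop F),
      ∃ (ι α π : Type) (_ : DecidableEq ι) (_ : DecidableEq α) (_ : DecidableEq π),
        Nonempty (CountRoadWitnessT3b (toyData F (Matrix.specialUnitaryGroup (Fin 1) ℂ)) C O rr d n hn g₀ os ι α π) :=
  haveI := subsingleton_SU1
  forSmallCouplings_countRoadWitnessT3b_toy F _ C O rr d n hn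

end Apex

/-! ## §4 The located obstruction on the placeholder inhabitant: the (γ) floor -/

section Stub

variable (F : T4Family) (G : Type) [GaugeGroup G] [MeasurableSpace G] [HaarData G] [RegularGaugeGroup G]

/-- **ON THE TREE'S OWN INHABITANT THE END-v3′ SHAPE IS EMPTY**: for `T4FiniteEpsInhabited.stubData` (χ := 0) there
is NO witness, whatever the constants, string, run and index types — the (γ) floor field asks
`0 < c₀ ≤ smallFieldMass = 0` (`smallFieldMass_stubData`). [decided toy] -/
theorem isEmpty_countRoadWitnessT3b_stubData (av : (K j : ℕ) → Averaging (F.P K) j G)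
    (hmeas : ∀ K j, Measurable (av K j).avg) (hac : ∀ K k, k < K → HaarAC (av K k).avg)
    (C : T4PrintedShapeBanking.Consts) (O : PrintedO1s) (rr d n : ℕ) (hn : 0 < n) (g₀ : ℕ → ℝ) (os : List (ULoop F))
    (ι α π : Type) [DecidableEq ι] [DecidableEq α] [DecidableEq π] :
    IsEmpty (CountRoadWitnessT3b (stubData F G av hmeas hac) C O rr d n hn g₀ os ι α π) :=
  ⟨fun X => by
    have h := X.floor X.K₀ le_rfl
    rw [smallFieldMass_stubData] at h
    exact absurd h (not_le.2 X.c₀_pos)⟩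

end Stub

end

end Summit.QuantumFields.BalabanUV.T4Continuum.HistoryRealiseCellsRunApexWitnessT3b
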